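import Summits.BirchSwinnertonDyer.Rank1Residual.Additive.TameBranchTeichmuller
import Summits.BirchSwinnertonDyer.Rank1Residual.Additive.TameBranchUpper
import Summits.BirchSwinnertonDyer.Rank1Residual.Additive.MinimalGoodOrdinaryField
import Summits.BirchSwinnertonDyer.Rank1Residual.Additive.DictionaryUniform
import HarnessLib

/-!
# Class N10, tame branch: JOINS — census X4-3 input + the typed tame-branch main conjecture ⟹
# `char_Λ X(E/ℚ_∞) = (p^k · B)` for the bridge's `B`; + `PlusSymbolsPIntegralAt` + `μ^alg = 0` ⟹
# `CycLeadingTermAt`; + a unit-coefficient certificate ⟹ `CycLeadingTermDvdAt` (cell `b2b-bsdres`,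
# lane CLASS-CLOSURE, seat cc-typer-2; team n1011 lead GEN 4 R5-10; by-name joins only)

HONEST FRAMING (cell `b2b-bsdres`, run/shared/lean/b2b/bsd-rank1-residual/, verbatim in every
file): the goal of the cell is to DELETE the COMBINATION-SHAPED residual classes of the
Birch–Swinnerton-Dyer formula for ALL analytic-rank `≤ 1` elliptic curves over `ℚ` — "full BSD
formula for every rank `≤ 1` curve in class `C`" assembled STRICTLY from published theorems — so
that the rank-`≤ 1` remainder becomes exactly the CONSTRUCTION-SHAPED classes, which are TYPED
(missing-input `Prop`s), NOT attempted. This is not "finishing BSD". Lane CLASS-CLOSURE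
(coordinator ruling 2026-08-21T04:07Z): research routes, no claim beyond the stated classes;
census output = EVIDENCE / conjecture items with held-out validation, NEVER a Literature fact;
the class N10 stays CONSTRUCTION-shaped (RESIDUAL-MAP §I); NOTHING is booked. THEOREMS ONLY; no
definition, no named fact, no conjecture node; every unproved input (`TameBranchRatCharEqAt`,
`CensusX43.OrdinaryTwistPartnerAt`, `PlusSymbolsPIntegralAt`, the unit-content / unit-coefficient
certificates, the `T = 0` period binder) is an explicit hypothesis (referee-1 rule R1); labels /
RESIDUAL-MAP marks UNCHANGED; nothing booked.

## What

On the census locus X4-3 (`p ≥ 5`, `E` additive at `p`, `SubGord`, `e ∈ {3,4,6}`; there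
`SubGord ⟹ TypeG ⟹ TypeGOrd` by `subGord_iff_typeG_of_addv` and
`typeGOrd_iff_typeG_of_semistabilityIndex_ne_two`), with `f` the newform of `E` and `χ = ω^{t(E,p)}`:
* `exists_isTameBranchOf_and_charIdeal_eq_of_tameBranchRatCharEq`: `TameBranchRatCharEqAt W p` +
  `OrdinaryTwistPartnerAt W p` ⟹ a tuple `(ã, B)` from the bridge (`TameBranchTeichmuller.lean` §5c)
  on which the typed MC is INSTANTIATED: every Selmer dual datum over the cyclotomic tower is
  `Λ`-torsion with `char = (g)`, `ι g = p^k · B`.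
* `cycLeadingTermAt_of_tameBranchRatCharEq_of_ordinaryTwistPartnerAt` (UPPER at `T = 0`): add
  `PlusSymbolsPIntegralAt W p` (`TameBranchUpper.lean`; a THEOREM on `Irr(E[p])` rows by p09-g2's
  T-R18b), unit content of the characteristic power series (`μ^alg = 0`) and the period binder
  `[0]⁺_f ∈ ℤ_p^× · L(E,1)/Ω_E` ⟹ `CycLeadingTermAt W p`; the bridge's integrality transfer
  discharges the `hint` binder of `cycLeadingTermAt_of_tameBranchRatCharEq_of_hasUnitContent_of_integral`.
* `cycLeadingTermDvdAt_of_tameBranchRatCharEq_of_ordinaryTwistPartnerAt` (LOWER at `T = 0`): add a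
  unit-coefficient certificate for the E-normalised `ω̄^t`-branch (quantified over every
  interpolation tuple; per pair it is read off the Riemann sums of the census symbol `Φ`, ENG-D) and
  `[0]⁺_f ∈ ℤ_p · L(E,1)/Ω_E` ⟹ `CycLeadingTermDvdAt W p`, whence the `r = 0` class consequences of
  `TameBranchLower.lean` §3 (`ClassX4Gord/ClassX3Gord.missingLowerBoundAt_rankZero_…`).
The `T = 0` binders are moved from `α`-normalisation to E-normalisation using `‖ã‖ = 1`
(`PadicInt.mkUnits`). UPSHOT: on X4-3 rows the analytic object of N10's tame-branch line costs
NOTHING beyond census X4-3's typed input. Nothing booked.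

References: HOME/cells/n1011/ROUTE-2.md §II.4–II.9; HOME/class-closure/typer-2/T-c4-ANSWER.md;
Mazur–Tate–Teitelbaum, Invent. Math. 84 (1986) §I.13–I.14 [MazurTateTeitelbaum1986Invent];
Delbourgo, Compositio Math. 113 (1998) §1.5–1.6 [Delbourgo1998].
-/

noncomputable section

open scoped Classical MatrixGroups ModularForm NumberField

open CongruenceSubgroup WeierstrassCurve NumberField Literature.NumberTheory.EllipticCurves
  Literature.NumberTheory.EllipticCurves.ModularForms
  Literature.NumberTheory.EllipticCurves.Rank1Residual
  Literature.NumberTheory.EllipticCurves.Rank1Residual.Typed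
  IsDedekindDomain

namespace Summit.BirchSwinnertonDyer.Rank1Residual.Additive

section Join

variable (W : WeierstrassCurve ℚ) [W.IsElliptic] [W.IsGloballyMinimal] (p : ℕ) [hp : Fact p.Prime]

/-- **JOIN with the typed main conjecture (N10 ← census X4-3).** On the X4-3 locus (`p ≥ 5`,
`E` additive at `p`, `SubGord`, `e ∈ {3,4,6}`), the census input `OrdinaryTwistPartnerAt W p`
supplies a tuple `(ι∘ω^{t(E,p)}, ã, B)` on which the typed RATIONAL tame-branch main conjecture
`TameBranchRatCharEqAt W p` (`TameBranchLower.lean`; NOT in print, nothing asserted) can be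
INSTANTIATED: every Selmer dual datum of `E` over the cyclotomic `ℤ_p`-extension is `Λ`-torsion with
characteristic power series `p^k · B` — the `B` being the Mellin transform of `χ̄·μ_Φ`, integral as
soon as the plus symbols are. Both inputs are explicit binders (referee-1 rule R1); nothing booked.
[folklore] -/
theorem exists_isTameBranchOf_and_charIdeal_eq_of_tameBranchRatCharEq
    (hT : TameBranchRatCharEqAt W p) (h : CensusX43.OrdinaryTwistPartnerAt W p) (h5 : 5 ≤ p)
    (hadd : Addv W p) (hG : SubGord W p) (he : semistabilityIndex W p ∈ ({3, 4, 6} : Finset ℕ))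
    {K : ZpExtension ℚ p} {γ : Field.absoluteGaloisGroup ℚ} (hK : K.IsCyclotomic)
    (hγ : K.IsTopGenerator γ) (hcyc : IsCyclotomicVariable p γ)
    {N : ℕ} [NeZero N] {f : CuspForm (Gamma0 N) 2} (hf : IsNewformOf W f)
    {χ : MulChar (ZMod p) ℚ_[p]}
    (hχ : CensusX43.IsTeichmullerPow χ (CensusX43.ordinaryTeichmullerExponent W p)) :
    ∃ (ã : ℚ_[p]) (B : PowerSeries ℚ_[p]), ‖ã‖ = 1 ∧
      IsTameBranchOf f p (χ.ringHomComp (algebraMap ℚ_[p] ℂ_[p])) ã B ∧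
      (∀ C : ℝ, (∀ r : ℚ, ‖((ratPlusSymbol f r : ℚ) : ℚ_[p])‖ ≤ C) →
        ∀ n : ℕ, ‖PowerSeries.coeff n B‖ ≤ C) ∧
      ∀ D : W.SelmerDualData K γ, D.IsTorsion ∧
        ∃ (g : IwasawaAlgebra p) (k : ℤ), D.charIdeal = Ideal.span {g} ∧
          iwasawaToPowerSeries p g = PowerSeries.C ((p : ℚ_[p]) ^ k) * B := by
  obtain ⟨ã, B, hã, hord, hB, hint⟩ :=
    exists_isTameBranchOf_of_ordinaryTwistPartnerAt W p h5 hG he h hf hχ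
  have hp2 : p ≠ 2 := by omega
  have hne2 : semistabilityIndex W p ≠ 2 := by
    simp only [Finset.mem_insert, Finset.mem_singleton] at he
    omega
  have hGord : TypeGOrd W p :=
    (typeGOrd_iff_typeG_of_semistabilityIndex_ne_two W p h5 hadd hne2).mpr
      ((subGord_iff_typeG_of_addv W p hp2 hadd).mp hG)
  exact ⟨ã, B, hã, hB, hint, hT _ ã B hp2 hadd (Or.inr hGord) hK hγ hcyc hf hord hã hB⟩


/-- **UPPER chain on X4-3 from the census input.** `TameBranchRatCharEqAt` (typed MC) +
`OrdinaryTwistPartnerAt` (census X4-3 input) + `PlusSymbolsPIntegralAt` (UPPER period half; a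
THEOREM on `Irr(E[p])` rows by p09-g2's T-R18b) + `μ^alg`-side unit content + the `T = 0` period
binder `[0]⁺_f ∈ ℤ_p^× · L(E,1)/Ω_E` ⟹ `CycLeadingTermAt W p`: the bridge's `B` is INTEGRAL
(`max ‖Φ‖ ≤ max ‖[·]⁺_f‖ ≤ 1`), which is the `hint` binder of
`cycLeadingTermAt_of_tameBranchRatCharEq_of_hasUnitContent_of_integral`; the binder is moved from
`α`-normalisation to E-normalisation using `‖ã‖ = 1`. Nothing asserted; nothing booked. [folklore] -/
theorem cycLeadingTermAt_of_tameBranchRatCharEq_of_ordinaryTwistPartnerAt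
    (hT : TameBranchRatCharEqAt W p) (h : CensusX43.OrdinaryTwistPartnerAt W p)
    (hPI : PlusSymbolsPIntegralAt W p) (h5 : 5 ≤ p) (hadd : Addv W p) (hG : SubGord W p)
    (he : semistabilityIndex W p ∈ ({3, 4, 6} : Finset ℕ))
    {N : ℕ} [NeZero N] {f : CuspForm (Gamma0 N) 2} (hf : IsNewformOf W f)
    {χ : MulChar (ZMod p) ℚ_[p]}
    (hχ : CensusX43.IsTeichmullerPow χ (CensusX43.ordinaryTeichmullerExponent W p))
    (hμ : ∀ (K : ZpExtension ℚ p) (γ : Field.absoluteGaloisGroup ℚ),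
      K.IsCyclotomic → K.IsTopGenerator γ → IsCyclotomicVariable p γ →
      ∀ (D : W.SelmerDualData K γ) (g : IwasawaAlgebra p), D.charIdeal = Ideal.span {g} →
        GreenbergVatsal2000.HasUnitContent g)
    {q : ℚ} (hq : W.entireLFunction 1 = (q : ℂ) * (W.realPeriodRat : ℂ))
    {u : ℤ_[p]ˣ} (hu : ((ratPlusSymbol f 0 : ℚ) : ℚ_[p]) = ((u : ℤ_[p]) : ℚ_[p]) * (q : ℚ_[p])) :
    CycLeadingTermAt W p := by
  obtain ⟨ã, B, hã, hord, hB, hint⟩ :=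
    exists_isTameBranchOf_of_ordinaryTwistPartnerAt W p h5 hG he h hf hχ
  have hp2 : p ≠ 2 := by omega
  have hne2 : semistabilityIndex W p ≠ 2 := by
    simp only [Finset.mem_insert, Finset.mem_singleton] at he
    omega
  have hGord : TypeGOrd W p :=
    (typeGOrd_iff_typeG_of_semistabilityIndex_ne_two W p h5 hadd hne2).mpr
      ((subGord_iff_typeG_of_addv W p hp2 hadd).mp hG)
  have hint1 : ∀ n : ℕ, ‖PowerSeries.coeff n B‖ ≤ 1 := hint 1 (hPI f hf)
  have hãi : ‖ã⁻¹‖ = 1 := by rw [norm_inv, hã, inv_one]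
  have hv : ã⁻¹ * ((ratPlusSymbol f 0 : ℚ) : ℚ_[p]) =
      (((PadicInt.mkUnits hãi * u : ℤ_[p]ˣ) : ℤ_[p]) : ℚ_[p]) * (q : ℚ_[p]) := by
    rw [hu, Units.val_mul, PadicInt.coe_mul, PadicInt.mkUnits_eq]
    ring
  exact cycLeadingTermAt_of_tameBranchRatCharEq_of_hasUnitContent_of_integral W p hT hp2 hadd
    (Or.inr hGord) hf hord hã hB hμ hint1 hq hv

/-- **LOWER chain on X4-3 from the census input.** `TameBranchRatCharEqAt` + `OrdinaryTwistPartnerAt`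
+ a UNIT-COEFFICIENT certificate for the E-normalised `ω̄^{t(E,p)}`-branch (quantified over every
interpolation tuple `(ι∘ω^t, ã, B)`; per pair it is read off the Riemann sums of the census symbol `Φ`,
ENG-D) + the `T = 0` period binder `[0]⁺_f ∈ ℤ_p · L(E,1)/Ω_E` ⟹ `CycLeadingTermDvdAt W p`
(`cycLeadingTermDvdAt_of_tameBranchRatCharEq_of_unitCoeff`), whence the r = 0 class consequences of
`TameBranchLower.lean` §3. Nothing asserted; nothing booked. [folklore] -/
theorem cycLeadingTermDvdAt_of_tameBranchRatCharEq_of_ordinaryTwistPartnerAt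
    (hT : TameBranchRatCharEqAt W p) (h : CensusX43.OrdinaryTwistPartnerAt W p)
    (h5 : 5 ≤ p) (hadd : Addv W p) (hG : SubGord W p)
    (he : semistabilityIndex W p ∈ ({3, 4, 6} : Finset ℕ))
    {N : ℕ} [NeZero N] {f : CuspForm (Gamma0 N) 2} (hf : IsNewformOf W f)
    {χ : MulChar (ZMod p) ℚ_[p]}
    (hχ : CensusX43.IsTeichmullerPow χ (CensusX43.ordinaryTeichmullerExponent W p))
    (hcert : ∀ (ã : ℚ_[p]) (B : PowerSeries ℚ_[p]), ‖ã‖ = 1 →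
      IsTameBranchOf f p (χ.ringHomComp (algebraMap ℚ_[p] ℂ_[p])) ã B →
        ∃ n : ℕ, ‖PowerSeries.coeff n B‖ = 1)
    {q : ℚ} (hq : W.entireLFunction 1 = (q : ℂ) * (W.realPeriodRat : ℂ))
    {z₀ : ℤ_[p]} (h0 : ((ratPlusSymbol f 0 : ℚ) : ℚ_[p]) = (z₀ : ℚ_[p]) * (q : ℚ_[p])) :
    CycLeadingTermDvdAt W p := by
  obtain ⟨ã, B, hã, hord, hB, -⟩ :=
    exists_isTameBranchOf_of_ordinaryTwistPartnerAt W p h5 hG he h hf hχ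
  have hp2 : p ≠ 2 := by omega
  have hne2 : semistabilityIndex W p ≠ 2 := by
    simp only [Finset.mem_insert, Finset.mem_singleton] at he
    omega
  have hGord : TypeGOrd W p :=
    (typeGOrd_iff_typeG_of_semistabilityIndex_ne_two W p h5 hadd hne2).mpr
      ((subGord_iff_typeG_of_addv W p hp2 hadd).mp hG)
  have hãi : ‖ã⁻¹‖ = 1 := by rw [norm_inv, hã, inv_one]
  have h0' : ã⁻¹ * ((ratPlusSymbol f 0 : ℚ) : ℚ_[p]) =
      ((((PadicInt.mkUnits hãi : ℤ_[p]ˣ) : ℤ_[p]) * z₀ : ℤ_[p]) : ℚ_[p]) * (q : ℚ_[p]) := by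
    rw [h0, PadicInt.coe_mul, PadicInt.mkUnits_eq]
    ring
  exact cycLeadingTermDvdAt_of_tameBranchRatCharEq_of_unitCoeff W p hT hp2 hadd (Or.inr hGord) hf
    hord hã hB (hcert ã B hã hB) hq h0'

end Join

end Summit.BirchSwinnertonDyer.Rank1Residual.Additive

end
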